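import Summits.ResolutionOfSingularities.ResolutionOfSingularities.Theorems.HilbertSamuelEliminationSigmaMaxModificationsCorridor3WLadderStrataBirthsTopDictionaryGraded
import HarnessLib

/-!
# [OURS · L1 W4.2] `Corridor3WLadderCPFrameTranslate` — D18 brick: CP frames under the translation `X ↦ X − θ`, and
# «a formal-hypersurface presentation ⇒ a MINIMAL CP frame» modulo Hironaka's vertex preparation (named fact)

Crux chain w42 (`SigmaMaxModifications`, stmt-ResolutionOfSingularities-18506; conjunct stmt-ResolutionOfSingularities-19249),
object D18 «HYPERSURFACE PROPAGATION + ADAPTED-FRAME EXISTENCE» (res-L1-w42-plan-1 RULINGS v3.12-4 (W), v3.13-1 (AF); dealt to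
res-D-pv-050 AS res-L1-s46-pv-12 by res-plan-2 09:05:51Z; CUT 09:33:13Z, «NO RE-CUT» 09:39:55Z). Helper file
`--supports stmt-ResolutionOfSingularities-19249 --as helper` (counted 0). OURS; NOT statements of H. Hironaka's manuscript
[Hironaka2017] nor of [CossartJannsenSaito2020]; AI-written, weaker than expert review.

WHAT. res-type-067's `IsCPFrame s R u h φ` (`…StrataBirthsTopDictionaryGraded`, p515936) asks for a Cossart–Piltant presentation
`φ : 𝒪_{X_n,x_n} → R[X]/(h)` (flat, local, unramified, residue-onto; `R` regular local of dimension `3`, `h` monic) whose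
characteristic polyhedron `Δ(h; u; X)` is MINIMAL (`CossartPiltant.IsMinimal u h`). Minimality is the one clause that is NOT
transported by blow-up charts away from the chart origin (CP 2019 Prop. 2.6 = tree `CossartPiltant.isMinimal_map_of_isMinimal`
covers the origin only) — it is re-gained by a TRANSLATION `X ↦ X − θ` (Hironaka's vertex preparation). This file provides:
* `isCPFrame_translate` — the eight non-minimality clauses of a CP frame are invariant under `X ↦ X − θ`, `θ ∈ R`
  (`h ↦ h(X + θ)`, `φ ↦ (R[X]/(h) ≅ R[X]/(h(X+θ))) ∘ φ`), so that a presentation whose TRANSLATE is minimal is a CP frame;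
* `exists_isCPFrame_of_presentation` — a flat, local, unramified, residue-onto presentation `φ : 𝒪_{X_n,x_n} → R[X]/(h)` over a
  COMPLETE regular local `R` of dimension `3` (`h` monic of degree `≥ 2`) yields a CP frame — MODULO the BINDER `hVP` = Hironaka's
  vertex preparation ([CossartPiltant2019] Prop. 2.2 «(Hironaka)» = Hironaka, J. Math. Kyoto Univ. 7 (1967), (3.10)/(4.8): over a
  COMPLETE regular local ring some translate `h(X + θ)` has no solvable vertex; F-number requested from the FACT desk). This is the
  «(P4) at translated near points» clause of the D18 cut: with it, propagation of `IsHypStage` along canonical near steps reduces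
  to transporting the non-minimality clauses (chart transform: tree `CharPolyhedronOriginChartMonic`, p519647).
What is NOT claimed: the blow-up transport itself ((P1)–(P3) of the cut); any statement of the manuscript; the binder `hVP`.
-/

noncomputable section

set_option linter.dupNamespace false

open CategoryTheory AlgebraicGeometry TopologicalSpace Polynomial IsLocalRing
open Summit.ResolutionOfSingularities.ResolutionOfSingularities.Theorems.CampaignW42
open Literature.AlgebraicGeometry.Resolution

namespace Summit.ResolutionOfSingularities.ResolutionOfSingularities.Theorems.SigmaMaxModificationsCorridor3.Moving

universe u v

/-! ## Translation of a CP frame -/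

section Translate

variable {R : Type} [CommRing R]

/-- The translation automorphism `X ↦ X + θ` of `R[X]` maps `h` to `h(X + θ)`. [folklore] -/
theorem algEquivAevalXAddC_apply (θ : R) (h : R[X]) : algEquivAevalXAddC θ h = h.comp (X + C θ) := by
  simp [algEquivAevalXAddC, algEquivOfCompEqX, comp_eq_aeval]

/-- The ideal `(h)` is carried to `(h(X + θ))` by the translation. [folklore] -/
theorem span_translate_eq_map (θ : R) (h : R[X]) :
    Ideal.span {h.comp (X + C θ)} = (Ideal.span {h}).map (algEquivAevalXAddC θ : R[X] →+* R[X]) := by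
  rw [Ideal.map_span, Set.image_singleton]
  exact congrArg _ (congrArg _ (algEquivAevalXAddC_apply θ h).symm)

/-- [OURS · L1 W4.2] **The non-minimality clauses of a CP frame are invariant under `X ↦ X − θ`.** Given a presentation
`φ : 𝒪_{X_n,x_n} → R[X]/(h)` with `R` regular local of dimension `3`, `(u) = 𝔪_R`, `h` monic, `R[X]/(h)` local, `φ` local, flat,
`𝔪 ↦ 𝔪` and residue-onto, and `θ ∈ R` such that the TRANSLATE `h(X + θ)` has a minimal polyhedron, the composite of `φ` with
`R[X]/(h) ≅ R[X]/(h(X + θ))` is a CP frame of the stage. [folklore] -/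
theorem isCPFrame_translate (s : MarkedStage.{u}) {u : Fin 3 → R} {h : R[X]}
    [hloc : IsLocalRing (R[X] ⧸ Ideal.span {h})]
    {φ : (s.W.presheaf.stalk s.pt : Type u) →+* R[X] ⧸ Ideal.span {h}}
    (hR : IsRegularLocalRing R) (hdim : ringKrullDim R = 3) (hu : Ideal.span (Set.range u) = maximalIdeal R)
    (hmon : h.Monic) (hφloc : IsLocalHom φ) (hflat : φ.Flat)
    (hmap : Ideal.map φ (maximalIdeal _) = maximalIdeal _)
    (hsurj : Function.Surjective ((residue _).comp φ))
    (θ : R) (hmin : CossartPiltant.IsMinimal u (h.comp (X + C θ))) :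
    ∃ φ' : (s.W.presheaf.stalk s.pt : Type u) →+* R[X] ⧸ Ideal.span {h.comp (X + C θ)},
      IsCPFrame s R u (h.comp (X + C θ)) φ' := by
  -- the quotient isomorphism induced by the translation
  let e : (R[X] ⧸ Ideal.span {h}) ≃+* R[X] ⧸ Ideal.span {h.comp (X + C θ)} :=
    Ideal.quotientEquiv (Ideal.span {h}) (Ideal.span {h.comp (X + C θ)})
      (algEquivAevalXAddC θ : R[X] ≃ₐ[R] R[X]).toRingEquiv (by
        rw [span_translate_eq_map]; rfl)
  haveI hloc' : IsLocalRing (R[X] ⧸ Ideal.span {h.comp (X + C θ)}) := e.isLocalRing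
  haveI := isLocalHom_toRingHom e
  haveI := hφloc
  refine ⟨(e : _ →+* _).comp φ, hR, hloc', hdim, hu, ?_, ?_, ?_, ?_, ?_, hmin⟩
  · -- monic
    exact hmon.comp (monic_X_add_C θ) (by rw [natDegree_X_add_C]; exact one_ne_zero)
  · -- local
    exact RingHom.isLocalHom_comp _ _
  · -- flat
    exact hflat.comp (RingHom.Flat.of_bijective e.bijective)
  · -- `𝔪 ↦ 𝔪`
    rw [← Ideal.map_map, hmap]
    exact map_ringEquiv_maximalIdeal e
  · -- residue-onto
    intro z
    obtain ⟨q', rfl⟩ := IsLocalRing.residue_surjective z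
    obtain ⟨a, ha⟩ := hsurj (residue _ (e.symm q'))
    refine ⟨a, ?_⟩
    have h1 := congrArg (ResidueField.map (e : _ →+* R[X] ⧸ Ideal.span {h.comp (X + C θ)})) ha
    simp only [RingHom.comp_apply, ResidueField.map_residue, RingEquiv.coe_toRingHom, RingEquiv.apply_symm_apply] at h1 ⊢
    exact h1

end Translate

/-! ## A minimal frame from any complete presentation, modulo the named fact -/

/-- [OURS · L1 W4.2] **A formal-hypersurface presentation over a COMPLETE base yields a (minimal) CP frame, modulo Hironaka's
vertex preparation.** The hypothesis `hVP` is the PUBLISHED fact [CossartPiltant2019] Prop. 2.2 «(Hironaka)» (arXiv v1 p. 11; =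
H. Hironaka, *Characteristic polyhedra of singularities*, J. Math. Kyoto Univ. 7 (1967), (3.10)/(4.8)) typed for the hypersurface
case over a COMPLETE regular local ring: for an r.s.p. `u` and a monic `h` of degree `≥ 2`, some translate `h(X + θ)` — `h` written in
`Z = X − θ` — has no solvable vertex (`CossartPiltant.IsMinimal`). It is carried as a BINDER (F-number requested from the FACT desk,
res-D-pv-050 09:40:58Z; NOT proved here, NOT a statement of the manuscript). Conclusion: if `φ : 𝒪_{X_n,x_n} → R[X]/(h)` is flat,
local, unramified and residue-onto, with `R` a complete regular local ring of dimension `3`, `(u) = 𝔪_R`, `R[X]/(h)` local and `h`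
monic of degree `≥ 2`, then the stage carries a CP frame in the sense of `IsCPFrame` (with the translated equation `h(X + θ)`).
This is clause (P4) of the D18 cut at NON-origin near points: blow-up charts transport every clause of a frame but minimality
(origin: tree `CossartPiltant.exists_monic_isMinimal_originChart`), and a frame over a complete `R` is legitimate since `φ` is only
required to be flat. [cite: CossartPiltant2019, Prop. 2.2 (arXiv v1 p. 11)] -/
theorem exists_isCPFrame_of_presentation
    (hVP : ∀ (n : ℕ) (S : Type) [CommRing S] [IsRegularLocalRing S], IsAdicComplete (maximalIdeal S) S →
      ∀ (u : Fin n → S), Ideal.span (Set.range u) = maximalIdeal S →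
        ∀ (h : S[X]), h.Monic → 2 ≤ h.natDegree → ∃ θ : S, CossartPiltant.IsMinimal u (h.comp (X + C θ)))
    (s : MarkedStage.{u})
    {R : Type} [CommRing R] {u : Fin 3 → R} {h : R[X]} [IsLocalRing (R[X] ⧸ Ideal.span {h})]
    {φ : (s.W.presheaf.stalk s.pt : Type u) →+* R[X] ⧸ Ideal.span {h}}
    (hR : IsRegularLocalRing R) (hcpl : IsAdicComplete (maximalIdeal R) R) (hdim : ringKrullDim R = 3)
    (hu : Ideal.span (Set.range u) = maximalIdeal R) (hmon : h.Monic) (hdeg : 2 ≤ h.natDegree)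
    (hφloc : IsLocalHom φ) (hflat : φ.Flat) (hmap : Ideal.map φ (maximalIdeal _) = maximalIdeal _)
    (hsurj : Function.Surjective ((residue _).comp φ)) :
    ∃ (θ : R) (φ' : (s.W.presheaf.stalk s.pt : Type u) →+* R[X] ⧸ Ideal.span {h.comp (X + C θ)}),
      IsCPFrame s R u (h.comp (X + C θ)) φ' := by
  haveI := hR
  obtain ⟨θ, hmin⟩ := hVP 3 R hcpl u hu h hmon hdeg
  obtain ⟨φ', hF⟩ := isCPFrame_translate s hR hdim hu hmon hφloc hflat hmap hsurj θ hmin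
  exact ⟨θ, φ', hF⟩

end Summit.ResolutionOfSingularities.ResolutionOfSingularities.Theorems.SigmaMaxModificationsCorridor3.Moving

end
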